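import Summits.CriticalPhenomena.PercolationContinuityZ3.Theorems.SahiIsingBoxTP2
import Summits.CriticalPhenomena.PercolationContinuityZ3.Theorems.SahiFKGBondMeasures
import Summits.CriticalPhenomena.PercolationContinuityZ3.Theorems.SahiIsingMeasures

/-!
# Unconditionally: two free slots for box-TP₂ spin laws — Sahi's Theorem 2 for the infinite-volume Ising states

Support file of the Sahi cell (`prim-sahi`, typer seat, generation 13; `--supports stmt-CriticalPhenomena-4575`).
Theorems only (no definitions, no named facts, no sorries).  Companion of `SahiIsingBoxTP2.lean` (the
infinite-volume Ising states `μ⁺`, `μ⁻`, `μ^∅` are box-TP₂) and `SahiIsingGibbsStates.lean` (their Sahi positivity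
GIVEN `C_n`).  Here: what holds WITHOUT any conjecture.

* `isFKGMeasure_map_restrict` — **the finite-window marginals of a box-TP₂ probability measure on `{−1,+1}^ι` have
  FKG-lattice (log-supermodular) point weights**: the cylinder over a window pattern `x ∈ {−1,+1}^J` is the box
  between the `−`-padding and the `+`-padding of `x` (`restrict_preimage_singleton_eq_Icc`, the tree's `glue`), and
  paddings commute with meets and joins (`glue_inf`, `glue_sup`).
* `msahiE_nonneg_offTwo_of_isBoxTP2_local` — hence, by Sahi's Theorem 2 / Blinovsky's theorem WITH TWO FREE SLOTS
  on the finite distributive lattice `{−1,+1}^J` (typer gen 9, `SahiFKGBondMeasures.msahiE_nonneg_offTwo_of_isFKGMeasure`):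
  **for every box-TP₂ probability measure `μ` on `{−1,+1}^ι` and every `n`, `0 ≤ E_n(f_0,…,f_{n−1})` whenever all
  `f_i` depend on the spins in a common finite window `J`, are nonnegative and increasing, at most two of them are
  arbitrary and every other one is the indicator of an all-plus event `{σ_v = +1 ∀ v ∈ A_i}`** (a lattice
  cumulation of `{−1,+1}^J`, `SahiIsingMeasures.isLatticeCumulation_plusSpins_comp_glue`).  `n = 3` displayed:
  `0 ≤ 2μ(P_A ∩ B ∩ C) + μ(P_A)μ(B)μ(C) − μ(P_A)μ(B ∩ C) − μ(B)μ(P_A ∩ C) − μ(C)μ(P_A ∩ B)` for local increasing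
  events `B, C` and `P_A = {σ_A ≡ +}` (`sahiE3_plusSpins_nonneg_of_isBoxTP2_local`).
* THE ISING STATES (`SahiIsingBoxTP2.isBoxTP2_of_forall_spinCorr_eq_plusCorr/minusCorr/freeCorr`):
  `plusState_msahiE_nonneg_plusSpins_offTwo`, `minusState_…` (`β ≥ 0`, every `h`), `freeState_…` (`β, h ≥ 0`) and the
  displayed `…_sahiE3_plusSpins_nonneg` — **Sahi's Theorem 2 with two free local slots for the infinite-volume
  Ising states on `ℤ^d`, unconditionally, every order `n`.**  (The finite-volume case is typer gen 9's
  `SahiIsingMeasures.isingMeasure_msahiE_nonneg_plusSpins_offTwo`; the all-slots statement for arbitrary measurable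
  monotone functionals is `SahiIsingGibbsStates.plusState_msahiE_nonneg`, conditional on `C_n`.)

Not done here: non-local free slots (needs an approximation argument; conditional version covers them).

No sorries, no new axioms.
-/

noncomputable section

namespace Summit.CriticalPhenomena.PercolationContinuityZ3.Theorems.SahiBoxTP2

open MeasureTheory ProbabilityTheory Set Filter Topology Function Literature.Combinatorics.Sahi2008
open Literature.Probability.LatticeModels
open scoped ENNReal

/-! ### Finite-window marginals of box-TP₂ spin laws have FKG point weights -/

section Marginal

variable {ι : Type*}

/-- **The cylinder over a window pattern is a box**: `{σ | σ|_J = x} = [glue J x −, glue J x +]`. [folklore] -/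
theorem restrict_preimage_singleton_eq_Icc (J : Finset ι) (x : ↥J → ℤˣ) :
    (fun σ : ι → ℤˣ => J.restrict σ) ⁻¹' {x} = Icc (glue J x .minus) (glue J x .plus) := by
  ext σ
  simp only [mem_preimage, mem_singleton_iff, mem_Icc, Pi.le_def]
  constructor
  · rintro rfl
    refine ⟨fun v => ?_, fun v => ?_⟩
    · by_cases hv : v ∈ J
      · rw [glue_apply_of_mem _ _ _ hv]; exact le_rfl
      · rw [glue_apply_of_notMem _ _ _ hv]; exact neg_one_le_intUnits _
    · by_cases hv : v ∈ J
      · rw [glue_apply_of_mem _ _ _ hv]; exact le_rfl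
      · rw [glue_apply_of_notMem _ _ _ hv]; exact intUnits_le_one _
  · rintro ⟨h1, h2⟩
    funext j
    have h1j := h1 j
    have h2j := h2 j
    rw [glue_apply_of_mem _ _ _ j.2] at h1j h2j
    exact le_antisymm h2j h1j

/-- Restriction to a window is measurable. [folklore] -/
theorem measurable_finsetRestrict (J : Finset ι) : Measurable fun σ : ι → ℤˣ => J.restrict σ :=
  measurable_pi_lambda _ fun j => measurable_pi_apply (j : ι)

/-- The point weights of the window marginal are the masses of the padding boxes. [folklore] -/
theorem map_restrict_real_singleton [Countable ι] (μ : Measure (ι → ℤˣ)) (J : Finset ι) (x : ↥J → ℤˣ) :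
    (μ.map fun σ : ι → ℤˣ => J.restrict σ).real {x} = μ.real (Icc (glue J x .minus) (glue J x .plus)) := by
  rw [measureReal_def, Measure.map_apply (measurable_finsetRestrict J) (measurableSet_singleton x),
    restrict_preimage_singleton_eq_Icc, ← measureReal_def]

/-- Box-TP₂ in real form. [folklore] -/
theorem IsBoxTP2.real_mul_le {β : Type*} [Lattice β] [MeasurableSpace β] {μ : Measure β} [IsFiniteMeasure μ]
    (hμ : IsBoxTP2 μ) (a b a' b' : β) :
    μ.real (Icc a b) * μ.real (Icc a' b') ≤ μ.real (Icc (a ⊓ a') (b ⊓ b')) * μ.real (Icc (a ⊔ a') (b ⊔ b')) := by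
  simp only [measureReal_def, ← ENNReal.toReal_mul]
  exact ENNReal.toReal_mono (ENNReal.mul_ne_top (measure_ne_top _ _) (measure_ne_top _ _)) (hμ a b a' b')

/-- **The finite-window marginals of a box-TP₂ probability measure on `{−1,+1}^ι` are FKG probability weights**
(log-supermodular point weights on the distributive lattice `{−1,+1}^J`). [this work] -/
theorem isFKGMeasure_map_restrict [Countable ι] [DecidableEq ι] (μ : Measure (ι → ℤˣ)) [IsProbabilityMeasure μ]
    (hμ : IsBoxTP2 μ) (J : Finset ι) : IsFKGMeasure fun x : ↥J → ℤˣ => (μ.map fun σ : ι → ℤˣ => J.restrict σ).real {x} where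
  nonneg _ := measureReal_nonneg
  sum_eq_one := by
    haveI : IsProbabilityMeasure (μ.map fun σ : ι → ℤˣ => J.restrict σ) :=
      Measure.isProbabilityMeasure_map (measurable_finsetRestrict J).aemeasurable
    rw [sum_measureReal_singleton, Finset.coe_univ, probReal_univ]
  mul_le_mul x y := by
    simp only [map_restrict_real_singleton, glue_inf, glue_sup]
    exact hμ.real_mul_le _ _ _ _

/-- A function of the spins in the window `J` factors through the restriction to `J` (padding by `+`).
[folklore] -/
theorem eq_comp_restrict_of_dependsOn (J : Finset ι) {f : (ι → ℤˣ) → ℝ} (hf : DependsOn f (↑J : Set ι)) :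
    f = (fun x : ↥J → ℤˣ => f (glue J x .plus)) ∘ fun σ : ι → ℤˣ => J.restrict σ := by
  funext σ
  simp only [Function.comp_apply]
  refine hf fun i hi => ?_
  rw [glue_apply_of_mem _ _ _ (Finset.mem_coe.1 hi)]
  rfl

end Marginal

/-! ### Two free slots for local families, unconditionally -/

section TwoFree

variable {ι : Type*} [Countable ι] [DecidableEq ι]

open scoped Classical in
/-- **Sahi's Theorem 2 / Blinovsky with two free slots for box-TP₂ spin laws, local families, every `n`**: for a
box-TP₂ probability measure `μ` on `{−1,+1}^ι` and `f_0,…,f_{n−1}` nonnegative, increasing, all depending on the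
spins in a finite window `J`, such that every slot outside a set `I` of at most two indices is the indicator of an
all-plus event `{σ_v = +1 ∀ v ∈ A_i}`: `0 ≤ E_n(f_0,…,f_{n−1})`.  (Marginal on `{−1,+1}^J` has FKG point weights;
`SahiFKGBondMeasures.msahiE_nonneg_offTwo_of_isFKGMeasure`.) [this work] -/
theorem msahiE_nonneg_offTwo_of_isBoxTP2_local (μ : Measure (ι → ℤˣ)) [IsProbabilityMeasure μ] (hμ : IsBoxTP2 μ)
    (J : Finset ι) {n : ℕ} (f : Fin n → (ι → ℤˣ) → ℝ) (hdep : ∀ i, DependsOn (f i) (↑J : Set ι))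
    (hf0 : ∀ i σ, 0 ≤ f i σ) (hmono : ∀ i, Monotone (f i)) (I : Finset (Fin n)) (hI : I.card ≤ 2)
    (A : Fin n → Finset ι) (hcum : ∀ i, i ∉ I → f i = {σ : ι → ℤˣ | ∀ v ∈ A i, σ v = 1}.indicator 1) :
    0 ≤ msahiE μ n f := by
  set r : (ι → ℤˣ) → (↥J → ℤˣ) := fun σ => J.restrict σ with hr
  set g : Fin n → (↥J → ℤˣ) → ℝ := fun i x => f i (glue J x .plus) with hg
  have hfg : f = fun i => g i ∘ r := funext fun i => eq_comp_restrict_of_dependsOn J (hdep i)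
  haveI : IsProbabilityMeasure (μ.map r) :=
    Measure.isProbabilityMeasure_map (measurable_finsetRestrict J).aemeasurable
  have hmp : MeasurePreserving r μ (μ.map r) := ⟨measurable_finsetRestrict J, rfl⟩
  rw [hfg, msahiE_comp_measurePreserving_of_measurable hmp n g fun i => measurable_of_countable _]
  refine SahiFKGBondMeasures.msahiE_nonneg_offTwo_of_isFKGMeasure (μ.map r) (isFKGMeasure_map_restrict μ hμ J) g
    (fun i x => hf0 i _) (fun i x y hxy => hmono i (glue_monotone J .plus hxy)) I hI fun i hi => ?_
  have e : g i = fun x : ↥J → ℤˣ =>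
      ({σ : ι → ℤˣ | ∀ v ∈ A i, σ v = 1}.indicator (1 : (ι → ℤˣ) → ℝ)) (glue J x .plus) := by
    funext x
    show f i (glue J x .plus) = _
    rw [hcum i hi]
  rw [e]
  exact SahiIsingMeasures.isLatticeCumulation_plusSpins_comp_glue J .plus (A i)

omit [Countable ι] [DecidableEq ι] in
/-- The all-plus event of a finite set of sites inside the window is local. [folklore] -/
theorem dependsOn_indicator_plusSpins {J A : Finset ι} (hA : A ⊆ J) :
    DependsOn ({σ : ι → ℤˣ | ∀ v ∈ A, σ v = 1}.indicator (1 : (ι → ℤˣ) → ℝ)) (↑J : Set ι) := by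
  intro σ τ hστ
  have e : (σ ∈ {σ : ι → ℤˣ | ∀ v ∈ A, σ v = 1}) = (τ ∈ {σ : ι → ℤˣ | ∀ v ∈ A, σ v = 1}) := by
    simp only [mem_setOf_eq]
    exact propext (forall₂_congr fun v hv => by rw [hστ v (Finset.mem_coe.2 (hA hv))])
  simp only [Set.indicator_apply, e, Pi.one_apply]

omit [Countable ι] [DecidableEq ι] in
/-- The indicator of a local event is local. [folklore] -/
theorem dependsOn_indicator_of_mem {J : Finset ι} {B : Set (ι → ℤˣ)} (hB : DependsOn (fun σ => σ ∈ B) (↑J : Set ι)) :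
    DependsOn (B.indicator (1 : (ι → ℤˣ) → ℝ)) (↑J : Set ι) := by
  classical
  intro σ τ hστ
  have e : (σ ∈ B) = (τ ∈ B) := hB hστ
  simp only [Set.indicator_apply, e, Pi.one_apply]

/-- **`n = 3` displayed, unconditionally**: for a box-TP₂ probability measure `μ` on `{−1,+1}^ι`, a finite set of
sites `A` and increasing measurable LOCAL events `B, C`:
`0 ≤ 2μ(P_A ∩ B ∩ C) + μ(P_A)μ(B)μ(C) − μ(P_A)μ(B ∩ C) − μ(B)μ(P_A ∩ C) − μ(C)μ(P_A ∩ B)`, `P_A = {σ_A ≡ +}`.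
[this work] -/
theorem sahiE3_plusSpins_nonneg_of_isBoxTP2_local (μ : Measure (ι → ℤˣ)) [IsProbabilityMeasure μ]
    (hμ : IsBoxTP2 μ) (J A : Finset ι) (hA : A ⊆ J) {B C : Set (ι → ℤˣ)} (hBm : MeasurableSet B)
    (hB : IsUpperSet B) (hBdep : DependsOn (fun σ => σ ∈ B) (↑J : Set ι)) (hCm : MeasurableSet C)
    (hC : IsUpperSet C) (hCdep : DependsOn (fun σ => σ ∈ C) (↑J : Set ι)) :
    0 ≤ sahiE3 μ {σ : ι → ℤˣ | ∀ v ∈ A, σ v = 1} B C := by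
  rw [← msahiE_three_indicator _ (measurableSet_forall_mem_eq_one A) hBm hCm]
  refine msahiE_nonneg_offTwo_of_isBoxTP2_local μ hμ J _ ?_ ?_ ?_ ({1, 2} : Finset (Fin 3)) (by decide)
    ![A, A, A] ?_
  · intro k
    fin_cases k
    · exact dependsOn_indicator_plusSpins hA
    · exact dependsOn_indicator_of_mem hBdep
    · exact dependsOn_indicator_of_mem hCdep
  · intro k σ
    fin_cases k <;> exact Set.indicator_nonneg (fun _ _ => zero_le_one) σ
  · intro k
    fin_cases k
    · exact Literature.Probability.Percolation.KNPreFKG.monotone_indicator_one_of_isUpperSet (isUpperSet_forall_mem_eq_one A)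
    · exact Literature.Probability.Percolation.KNPreFKG.monotone_indicator_one_of_isUpperSet hB
    · exact Literature.Probability.Percolation.KNPreFKG.monotone_indicator_one_of_isUpperSet hC
  · intro k hk
    fin_cases k
    · rfl
    · simp at hk
    · simp at hk

end TwoFree

/-! ### The infinite-volume Ising states on `ℤ^d` -/

section Ising

variable {d : ℕ} {β h : ℝ} {n : ℕ}

/-- **Sahi's Theorem 2 with two free local slots for the PLUS STATE, unconditionally, every `n`** (`β ≥ 0`, any
`h`): for every probability measure `μ` on `{−1,+1}^{ℤ^d}` with the plus correlations and `f_0,…,f_{n−1}` nonnegative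
increasing functions of the spins in a finite window `J`, all but at most two of which are indicators of all-plus
events `{σ_v = +1 ∀ v ∈ A_i}`: `0 ≤ E_n(f_0,…,f_{n−1})`. [this work] -/
theorem plusState_msahiE_nonneg_plusSpins_offTwo (hβ : 0 ≤ β) (μ : Measure (SpinConfig (Site d)))
    [IsProbabilityMeasure μ] (hμ : ∀ B : Finset (Site d), spinCorr μ B = plusCorr d β h B) (J : Finset (Site d))
    (f : Fin n → SpinConfig (Site d) → ℝ) (hdep : ∀ i, DependsOn (f i) (↑J : Set (Site d)))
    (hf0 : ∀ i σ, 0 ≤ f i σ) (hmono : ∀ i, Monotone (f i)) (I : Finset (Fin n)) (hI : I.card ≤ 2)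
    (A : Fin n → Finset (Site d))
    (hcum : ∀ i, i ∉ I → f i = {σ : SpinConfig (Site d) | ∀ v ∈ A i, σ v = 1}.indicator 1) :
    0 ≤ msahiE μ n f :=
  msahiE_nonneg_offTwo_of_isBoxTP2_local μ (isBoxTP2_of_forall_spinCorr_eq_plusCorr hβ μ hμ) J f hdep hf0 hmono I
    hI A hcum

/-- The same for the MINUS STATE (`β ≥ 0`, any `h`). [this work] -/
theorem minusState_msahiE_nonneg_plusSpins_offTwo (hβ : 0 ≤ β) (μ : Measure (SpinConfig (Site d)))
    [IsProbabilityMeasure μ] (hμ : ∀ B : Finset (Site d), spinCorr μ B = minusCorr d β h B) (J : Finset (Site d))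
    (f : Fin n → SpinConfig (Site d) → ℝ) (hdep : ∀ i, DependsOn (f i) (↑J : Set (Site d)))
    (hf0 : ∀ i σ, 0 ≤ f i σ) (hmono : ∀ i, Monotone (f i)) (I : Finset (Fin n)) (hI : I.card ≤ 2)
    (A : Fin n → Finset (Site d))
    (hcum : ∀ i, i ∉ I → f i = {σ : SpinConfig (Site d) | ∀ v ∈ A i, σ v = 1}.indicator 1) :
    0 ≤ msahiE μ n f :=
  msahiE_nonneg_offTwo_of_isBoxTP2_local μ (isBoxTP2_of_forall_spinCorr_eq_minusCorr hβ μ hμ) J f hdep hf0 hmono I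
    hI A hcum

/-- The same for the FREE STATE (`β ≥ 0`, `h ≥ 0`). [this work] -/
theorem freeState_msahiE_nonneg_plusSpins_offTwo (hβ : 0 ≤ β) (hh : 0 ≤ h) (μ : Measure (SpinConfig (Site d)))
    [IsProbabilityMeasure μ] (hμ : ∀ B : Finset (Site d), spinCorr μ B = freeCorr d β h B) (J : Finset (Site d))
    (f : Fin n → SpinConfig (Site d) → ℝ) (hdep : ∀ i, DependsOn (f i) (↑J : Set (Site d)))
    (hf0 : ∀ i σ, 0 ≤ f i σ) (hmono : ∀ i, Monotone (f i)) (I : Finset (Fin n)) (hI : I.card ≤ 2)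
    (A : Fin n → Finset (Site d))
    (hcum : ∀ i, i ∉ I → f i = {σ : SpinConfig (Site d) | ∀ v ∈ A i, σ v = 1}.indicator 1) :
    0 ≤ msahiE μ n f :=
  msahiE_nonneg_offTwo_of_isBoxTP2_local μ (isBoxTP2_of_forall_spinCorr_eq_freeCorr hβ hh μ hμ) J f hdep hf0 hmono
    I hI A hcum

/-- **PLUS STATE, `n = 3` displayed, unconditionally**: for `β ≥ 0`, any `h`, a finite set of sites `A` and
increasing local events `B, C`:
`0 ≤ 2μ⁺(P_A ∩ B ∩ C) + μ⁺(P_A)μ⁺(B)μ⁺(C) − μ⁺(P_A)μ⁺(B ∩ C) − μ⁺(B)μ⁺(P_A ∩ C) − μ⁺(C)μ⁺(P_A ∩ B)`. [this work] -/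
theorem plusState_sahiE3_plusSpins_nonneg (hβ : 0 ≤ β) (μ : Measure (SpinConfig (Site d)))
    [IsProbabilityMeasure μ] (hμ : ∀ B : Finset (Site d), spinCorr μ B = plusCorr d β h B)
    (J A : Finset (Site d)) (hA : A ⊆ J) {B C : Set (SpinConfig (Site d))} (hBm : MeasurableSet B)
    (hB : IsUpperSet B) (hBdep : DependsOn (fun σ => σ ∈ B) (↑J : Set (Site d))) (hCm : MeasurableSet C)
    (hC : IsUpperSet C) (hCdep : DependsOn (fun σ => σ ∈ C) (↑J : Set (Site d))) :
    0 ≤ sahiE3 μ {σ : SpinConfig (Site d) | ∀ v ∈ A, σ v = 1} B C :=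
  sahiE3_plusSpins_nonneg_of_isBoxTP2_local μ (isBoxTP2_of_forall_spinCorr_eq_plusCorr hβ μ hμ) J A hA hBm hB hBdep
    hCm hC hCdep

/-- MINUS STATE, `n = 3` displayed. [this work] -/
theorem minusState_sahiE3_plusSpins_nonneg (hβ : 0 ≤ β) (μ : Measure (SpinConfig (Site d)))
    [IsProbabilityMeasure μ] (hμ : ∀ B : Finset (Site d), spinCorr μ B = minusCorr d β h B)
    (J A : Finset (Site d)) (hA : A ⊆ J) {B C : Set (SpinConfig (Site d))} (hBm : MeasurableSet B)
    (hB : IsUpperSet B) (hBdep : DependsOn (fun σ => σ ∈ B) (↑J : Set (Site d))) (hCm : MeasurableSet C)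
    (hC : IsUpperSet C) (hCdep : DependsOn (fun σ => σ ∈ C) (↑J : Set (Site d))) :
    0 ≤ sahiE3 μ {σ : SpinConfig (Site d) | ∀ v ∈ A, σ v = 1} B C :=
  sahiE3_plusSpins_nonneg_of_isBoxTP2_local μ (isBoxTP2_of_forall_spinCorr_eq_minusCorr hβ μ hμ) J A hA hBm hB
    hBdep hCm hC hCdep

/-- FREE STATE (`h ≥ 0`), `n = 3` displayed. [this work] -/
theorem freeState_sahiE3_plusSpins_nonneg (hβ : 0 ≤ β) (hh : 0 ≤ h) (μ : Measure (SpinConfig (Site d)))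
    [IsProbabilityMeasure μ] (hμ : ∀ B : Finset (Site d), spinCorr μ B = freeCorr d β h B)
    (J A : Finset (Site d)) (hA : A ⊆ J) {B C : Set (SpinConfig (Site d))} (hBm : MeasurableSet B)
    (hB : IsUpperSet B) (hBdep : DependsOn (fun σ => σ ∈ B) (↑J : Set (Site d))) (hCm : MeasurableSet C)
    (hC : IsUpperSet C) (hCdep : DependsOn (fun σ => σ ∈ C) (↑J : Set (Site d))) :
    0 ≤ sahiE3 μ {σ : SpinConfig (Site d) | ∀ v ∈ A, σ v = 1} B C :=
  sahiE3_plusSpins_nonneg_of_isBoxTP2_local μ (isBoxTP2_of_forall_spinCorr_eq_freeCorr hβ hh μ hμ) J A hA hBm hB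
    hBdep hCm hC hCdep

end Ising

end Summit.CriticalPhenomena.PercolationContinuityZ3.Theorems.SahiBoxTP2
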